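import Summits.CriticalPhenomena.PercolationContinuityZ3.Theorems.PercNearOneGluingNoHeavyLowerTailSahiCoordinateBernstein
import Summits.CriticalPhenomena.PercolationContinuityZ3.Theorems.PercNearOneGluingNoHeavyLowerTailSahiFloorTransfer
import Summits.CriticalPhenomena.PercolationContinuityZ3.Theorems.PercNearOneGluingNoHeavyLowerTailSahiCombSubcube
import Summits.CriticalPhenomena.PercolationContinuityZ3.Theorems.SahiMasterFamily
import Mathlib.Tactic.Linarith
import Mathlib.Tactic.Ring
import HarnessLib

/-!
# `NoHeavyLowerTail` (crux stmt-CriticalPhenomena-4575), master-family line P2: THE COORDINATE INDUCTION —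
# "every doubly-terminal triple has a good coordinate" ⟹ Kahn's `C_3` for every product measure (`MasterFamilyNonneg 3`)

Support file (seat `prim-masterthm-p2`, gen 5; `--supports stmt-CriticalPhenomena-4575`).  No `sorry`, standard axioms.  Memo SAHI-ROUTE.md §4.15–4.16.

What this file does.
* `not_DTEGC` — the conjecture `SahiCoordinateBernstein.DTEGC` AS TYPED in p227256 is (vacuously) FALSE: on the EMPTY index type the triple
  `(∅, Ω, Ω)` is doubly-terminal and there is no coordinate at all.  This is a typing defect (missing `Nonempty ι`), not a mathematical one.
* `DTEGC'` — the corrected conjecture (same statement on NONEMPTY index types) and `DTEGCWeak` — the weaker ∃-form the induction actually needs: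
  some coordinate `e` with `(1 − p_e)·b₁(e) + p_e·b₂(e) ≥ 0`, i.e. `E_3(μ_p; U) ≥ E_{x_e}[E_3 of the e-sections]`;  `dtegcWeak_of_dtegc'`.
* `coordPiece₁_sub_coordPiece₂`, `coordPiece₂_le_coordPiece₁` — `b₁ − b₂ = c₃ = ∏_j (X₁ − X₀)(1_{U_j}) ≥ 0` (top coefficient of the fibre cubic), so
  "good" is the single inequality `b₂ ≥ 0` (`good_iff_coordPiece₂_nonneg`).
* **`sahiPositive_three_of_DTEGCWeak`**, **`masterFamilyNonneg_three_of_DTEGCWeak`**, **`masterFamilyNonneg_three_of_DTEGC'`** — THE INDUCTION ON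
  THE NUMBER OF COORDINATES: base `|ι| ≤ 3` is the kernel certificate `masterFamilyNonneg_three_of_card_le_three`; step: Harris (`isFKGMeasure_bernoulliWeight`)
  + the doubly-terminal reduction `SahiFrontierTransfer.sahiPositive_three_iff_doublyTerminal` (p226067) + a good coordinate `e` + the one-coordinate
  decomposition `SahiCoordinateBernstein.sahiE_three_decomp_coord` (p227256) + transport of the `e`-sections to the sub-cube `↥({e}ᶜ)`
  (`SahiCombJunta.sahiE_comp_restr`, P3) where the induction hypothesis applies.
So Kahn's Conjecture 5 (= `MasterFamilyNonneg 3`, `masterFamilyNonneg_three_iff_kahnConjecture`) is reduced, in the kernel, to the single census-clean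
combinatorial-probabilistic statement `DTEGCWeak` about doubly-terminal triples (cp-ps3 DTERM.md §4: k = 5 exhaustive over the 1 552 core orbits ×
Sym(5)-invariant grids, 127 240 720 exact cells, 0 violations of the STRONG form; coordinate-transitive k = 6, 7: 0).
-/

noncomputable section

open scoped Classical

namespace Summit.CriticalPhenomena.PercolationContinuityZ3.Theorems

namespace SahiCoordinateInduction

open Finset Function Polynomial
open Literature.Combinatorics.Sahi2008
open Literature.Probability.Percolation (DeterminedBy determinedBy_iff)
open Literature.Probability.Percolation.DecisionTree (ind ind_of_mem ind_of_not_mem ind_nonneg)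
open SahiCoordinateBernstein (coordPiece₁ coordPiece₂ DTEGC sahiE_three_decomp_coord)

/-! ### The typed conjecture of p227256 is vacuously false on the empty index type -/

/-- **`DTEGC` as typed is FALSE**: on `ι = Fin 0` the triple `(∅, Ω, Ω)` of up-sets is frontier- and floor-terminal, and `∃ e : Fin 0, …` fails.
A typing defect (the intended statement is `DTEGC'` below, on nonempty index types). [this work] -/
theorem not_DTEGC : ¬ DTEGC := by
  intro h
  have hW : ∀ j, IsUpperSet ((( ![∅, univ, univ] : Fin 3 → Finset (Set (Fin 0))) j : Finset (Set (Fin 0))) : Set (Set (Fin 0))) := by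
    intro j; fin_cases j
    · intro a b _ ha; exact absurd (Finset.mem_coe.1 ha) (Finset.notMem_empty _)
    · intro a b _ _; exact Finset.mem_coe.2 (Finset.mem_univ _)
    · intro a b _ _; exact Finset.mem_coe.2 (Finset.mem_univ _)
  obtain ⟨e, -, -⟩ := h (Fin 0) (fun i => i.elim0) ![∅, univ, univ] hW
    (by
      intro j z hz _ l hl
      fin_cases j
      · fin_cases l
        · exact absurd rfl hl
        · exact mem_univ _
        · exact mem_univ _
      · exact absurd (mem_univ _) hz
      · exact absurd (mem_univ _) hz)
    (by
      intro j m hm _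
      fin_cases j
      · simp at hm
      · exact ⟨0, by decide, by simp⟩
      · exact ⟨0, by decide, by simp⟩)
  exact e.elim0

/-! ### The corrected conjecture and its weak form -/

/-- **CONJECTURE DT-EGC (corrected typing: nonempty index type)**, an obligation of this programme (NOT a published fact): for every product weight on a
finite NONEMPTY cube and every triple of up-sets that is frontier-terminal and floor-terminal, some coordinate has both one-coordinate Bernstein pieces
`≥ 0`.  Census: cp-ps3 DTERM.md §4 (k = 5 exhaustive core × grids: 127 240 720 exact cells, 0 violations; coordinate-transitive k = 6, 7: 0) and the
seat's §4.15(c).  The general (non-terminal) form is false (hexagon). [cite: Kahn2022, Conj. 5 (arXiv p. 3)] [status: open] -/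
@[conjecture] def DTEGC' : Prop :=
  ∀ (ι : Type) [Fintype ι] [Nonempty ι] (p : ι → unitInterval) (W : Fin 3 → Finset (Set ι)),
    (∀ j, IsUpperSet ((W j : Finset (Set ι)) : Set (Set ι))) →
    (∀ j z, z ∉ W j → (∀ y, z < y → y ∈ W j) → ∀ l, l ≠ j → z ∈ W l) →
    (∀ j m, m ∈ W j → (∀ y, y ∈ W j → y ≤ m → y = m) → ∃ l, l ≠ j ∧ m ∉ W l) →
      ∃ e, 0 ≤ coordPiece₁ p e (fun j => ((W j : Finset (Set ι)) : Set (Set ι))) ∧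
        0 ≤ coordPiece₂ p e (fun j => ((W j : Finset (Set ι)) : Set (Set ι)))

/-- **CONJECTURE DT-EGC, WEAK FORM** (what the induction uses): on a nonempty cube every doubly-terminal triple of up-sets has a coordinate `e` with
`(1 − p_e)·b₁(e) + p_e·b₂(e) ≥ 0`, i.e. `E_3(μ_p; U)` is at least the `x_e`-average of `E_3` of the two `e`-sections.  Implied by `DTEGC'`
(`dtegcWeak_of_dtegc'`). [cite: Kahn2022, Conj. 5 (arXiv p. 3)] [status: open] -/
@[conjecture] def DTEGCWeak : Prop :=
  ∀ (ι : Type) [Fintype ι] [Nonempty ι] (p : ι → unitInterval) (W : Fin 3 → Finset (Set ι)),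
    (∀ j, IsUpperSet ((W j : Finset (Set ι)) : Set (Set ι))) →
    (∀ j z, z ∉ W j → (∀ y, z < y → y ∈ W j) → ∀ l, l ≠ j → z ∈ W l) →
    (∀ j m, m ∈ W j → (∀ y, y ∈ W j → y ≤ m → y = m) → ∃ l, l ≠ j ∧ m ∉ W l) →
      ∃ e, 0 ≤ (1 - (p e : ℝ)) * coordPiece₁ p e (fun j => ((W j : Finset (Set ι)) : Set (Set ι))) +
        (p e : ℝ) * coordPiece₂ p e (fun j => ((W j : Finset (Set ι)) : Set (Set ι)))

/-- The strong form implies the weak form (a convex combination of two nonnegative pieces). [this work] -/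
theorem dtegcWeak_of_dtegc' (h : DTEGC') : DTEGCWeak := by
  intro ι _ _ p W hW hT1 hT2
  obtain ⟨e, h1, h2⟩ := h ι p W hW hT1 hT2
  refine ⟨e, add_nonneg (mul_nonneg ?_ h1) (mul_nonneg (p e).2.1 h2)⟩
  have := (p e).2.2
  linarith

/-! ### `b₁ − b₂` is the top coefficient `∏ (X₁ − X₀) ≥ 0`: goodness is the single inequality `b₂ ≥ 0` -/

variable {ι : Type} [Fintype ι]

/-- `b₁(e) − b₂(e) = c₃ = ∏_j (X₁(1_{U_j}) − X₀(1_{U_j}))`, the product of the three influences along `e`. [this work] -/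
theorem coordPiece₁_sub_coordPiece₂ (p : ι → unitInterval) (e : ι) (U : Fin 3 → Set (Set ι)) :
    coordPiece₁ p e U - coordPiece₂ p e U = ∏ j, (secEx p e (ind (U j)) true - secEx p e (ind (U j)) false) := by
  have htop : (sahiEP (secPoly p e) 3 fun j => ind (U j)).coeff 3 = (-1) ^ 2 * ∏ j, (secPoly p e (ind (U j))).coeff 1 :=
    coeff_sahiEP_top (secPoly p e) (natDegree_secPoly_le p e) 2 (fun j => ind (U j))
  simp only [coeff_secPoly_one] at htop
  have h3 : (sahiEP (secPoly p e) 3 fun j => ind (U j)).coeff 3 = ∏ j, (secEx p e (ind (U j)) true - secEx p e (ind (U j)) false) := by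
    rw [htop]; norm_num
  simp only [coordPiece₁, coordPiece₂]
  linarith

/-- For increasing events the influences are `≥ 0`, hence **`b₂(e) ≤ b₁(e)`**. [this work] -/
theorem coordPiece₂_le_coordPiece₁ (p : ι → unitInterval) (e : ι) (U : Fin 3 → Set (Set ι)) (hU : ∀ j, IsUpperSet (U j)) :
    coordPiece₂ p e U ≤ coordPiece₁ p e U := by
  have h := coordPiece₁_sub_coordPiece₂ p e U
  have hprod : 0 ≤ ∏ j, (secEx p e (ind (U j)) true - secEx p e (ind (U j)) false) := by
    refine Finset.prod_nonneg fun j _ => ?_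
    simp only [secEx, Bool.false_eq_true, if_false, if_true]
    rw [← Finset.sum_sub_distrib]
    refine Finset.sum_nonneg fun ω _ => ?_
    rw [← mul_sub]
    exact mul_nonneg (offWeight_nonneg p e ω) (sub_nonneg.2 (monotone_ind_of_isUpperSet (hU j) (Set.subset_insert e ω)))
  linarith

/-- **Goodness is one inequality**: for increasing events, `e` is good (`b₁, b₂ ≥ 0`) iff `b₂(e) ≥ 0`. [this work] -/
theorem good_iff_coordPiece₂_nonneg (p : ι → unitInterval) (e : ι) (U : Fin 3 → Set (Set ι)) (hU : ∀ j, IsUpperSet (U j)) :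
    (0 ≤ coordPiece₁ p e U ∧ 0 ≤ coordPiece₂ p e U) ↔ 0 ≤ coordPiece₂ p e U :=
  ⟨fun h => h.2, fun h => ⟨h.trans (coordPiece₂_le_coordPiece₁ p e U hU), h⟩⟩

/-! ### Plumbing: finset indicators, the bridge to `SahiPositive`, sections live on the sub-cube -/

omit [Fintype ι] in
/-- `setInd W = ind ↑W`. [folklore] -/
theorem setInd_eq_ind (W : Finset (Set ι)) : setInd W = ind ((W : Finset (Set ι)) : Set (Set ι)) := by
  funext ω
  by_cases h : ω ∈ W
  · rw [setInd_apply, if_pos h, ind_of_mem (Finset.mem_coe.2 h)]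
  · rw [setInd_apply, if_neg h, ind_of_not_mem fun h' => h (Finset.mem_coe.1 h')]

/-- `SahiPositive μ_p 3` gives `E_3 ≥ 0` on every triple of increasing events (the direction we consume). [folklore] -/
theorem sahiE_three_nonneg_of_sahiPositive (p : ι → unitInterval) (h : SahiPositive (bernoulliWeight p) 3)
    (U : Fin 3 → Set (Set ι)) (hU : ∀ j, IsUpperSet (U j)) : 0 ≤ sahiE (bernoulliWeight p) 3 (fun j => ind (U j)) :=
  h _ (fun _ _ => ind_nonneg _ _) (fun j => monotone_ind_of_isUpperSet (hU j))

/-- Conversely, `E_3 ≥ 0` on increasing events gives `SahiPositive μ_p 3` (layer-cake reduction `sahiPositive_iff_indicators`). [folklore] -/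
theorem sahiPositive_three_of_forall (p : ι → unitInterval)
    (h : ∀ U : Fin 3 → Set (Set ι), (∀ j, IsUpperSet (U j)) → 0 ≤ sahiE (bernoulliWeight p) 3 (fun j => ind (U j))) :
    SahiPositive (bernoulliWeight p) 3 := by
  refine (sahiPositive_iff_indicators (bernoulliWeight p) 3).2 fun W hW => ?_
  have hfun : (fun i => setInd (W i)) = fun i => ind ((W i : Finset (Set ι)) : Set (Set ι)) := by
    funext i; exact setInd_eq_ind (W i)
  rw [hfun]
  exact h _ hW

/-- **The `e`-sections live on the sub-cube `↥(univ.erase e)`**: `E_3(μ_p; U^{e←b}) = E_3(μ_{p|}; trace family)` there. [this work] -/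
theorem sahiE_three_secAt_eq_subcube (p : ι → unitInterval) (e : ι) (b : Bool) (U : Fin 3 → Set (Set ι)) :
    sahiE (bernoulliWeight p) 3 (fun j => ind (secAt e b (U j))) =
      sahiE (bernoulliWeight (p ∘ Subtype.val)) 3
        (fun j => ind (SahiCombJunta.traceFam (↑(Finset.univ.erase e) : Set ι) (secAt e b (U j)))) := by
  -- every event on a finite index type is determined by `univ` (as in `…SahiMasterFamilyMinors`), so its sections are determined by `univ.erase e`
  have hdet : ∀ j, DeterminedBy (secAt e b (U j)) (↑(Finset.univ.erase e) : Set ι) := fun j => by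
    refine determinedBy_secAt e b ((determinedBy_iff _ _).2 fun ω ω' hωω' => ?_)
    simp only [Finset.coe_univ, Set.inter_univ] at hωω'
    rw [hωω']
  have hfun : (fun j => ind (secAt e b (U j))) =
      fun j => ind (SahiCombJunta.traceFam (↑(Finset.univ.erase e) : Set ι) (secAt e b (U j))) ∘
        SahiCombJunta.restr (↑(Finset.univ.erase e) : Set ι) := by
    funext j; exact SahiCombJunta.ind_eq_comp_restr_of_determinedBy _ (hdet j)
  rw [hfun, SahiCombJunta.sahiE_comp_restr]
  congr!

/-- The sub-cube `↥(univ.erase e)` has one coordinate fewer. [folklore] -/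
theorem card_subcube_erase (e : ι) : Fintype.card ↥(↑(Finset.univ.erase e) : Set ι) = Fintype.card ι - 1 := by
  rw [show Fintype.card ↥(↑(Finset.univ.erase e) : Set ι) = (Finset.univ.erase e).card from
      Fintype.card_of_subtype (Finset.univ.erase e) (fun _ => Iff.rfl),
    Finset.card_erase_of_mem (Finset.mem_univ e), Finset.card_univ]

/-! ### The induction on the number of coordinates -/

/-- **THE COORDINATE INDUCTION.**  Under `DTEGCWeak`, `SahiPositive μ_p 3` for every product weight on every finite cube: induction on `|ι|`, base
`|ι| ≤ 3` (kernel certificate), step = Harris + doubly-terminal reduction + a good coordinate + one-coordinate decomposition + sub-cube transport.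
[this work] -/
theorem sahiPositive_three_of_DTEGCWeak (h : DTEGCWeak) :
    ∀ (n : ℕ) (ι : Type) [Fintype ι], Fintype.card ι = n → ∀ p : ι → unitInterval, SahiPositive (bernoulliWeight p) 3 := by
  intro n
  induction n with
  | zero =>
    intro ι _ hcard p
    exact sahiPositive_three_of_forall p fun U hU => masterFamilyNonneg_three_of_card_le_three (by omega) p U hU
  | succ n ih =>
    intro ι _ hcard p
    haveI : Nonempty ι := Fintype.card_pos_iff.1 (by omega)
    refine (SahiFrontierTransfer.sahiPositive_three_iff_doublyTerminal (isFKGMeasure_bernoulliWeight p)).2 fun W hW hT1 hT2 => ?_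
    have hfun : (fun i => setInd (W i)) = fun i => ind ((W i : Finset (Set ι)) : Set (Set ι)) := by
      funext i; exact setInd_eq_ind (W i)
    rw [hfun]
    obtain ⟨e, he⟩ := h ι p W hW hT1 hT2
    -- the two `e`-sections are nonnegative by the induction hypothesis on the sub-cube
    have hsec : ∀ b : Bool, 0 ≤ sahiE (bernoulliWeight p) 3 (fun j => ind (secAt e b (((W j : Finset (Set ι)) : Set (Set ι))))) := by
      intro b
      rw [sahiE_three_secAt_eq_subcube]
      have hcard' : Fintype.card ↥(↑(Finset.univ.erase e) : Set ι) = n := by rw [card_subcube_erase, hcard]; rfl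
      exact sahiE_three_nonneg_of_sahiPositive _ (ih _ hcard' _) _ fun j =>
        SahiCombJunta.isUpperSet_traceFam _ (isUpperSet_secAt e b (hW j))
    -- one-coordinate decomposition
    rw [sahiE_three_decomp_coord p e]
    have hp0 : 0 ≤ (p e : ℝ) := (p e).2.1
    have hp1 : (p e : ℝ) ≤ 1 := (p e).2.2
    have hq : 0 ≤ 1 - (p e : ℝ) := by linarith
    have ht : 0 ≤ (p e : ℝ) * (1 - (p e : ℝ)) *
        ((1 - (p e : ℝ)) * coordPiece₁ p e (fun j => ((W j : Finset (Set ι)) : Set (Set ι))) +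
          (p e : ℝ) * coordPiece₂ p e (fun j => ((W j : Finset (Set ι)) : Set (Set ι)))) :=
      mul_nonneg (mul_nonneg hp0 hq) he
    nlinarith [mul_nonneg hq (hsec false), mul_nonneg hp0 (hsec true)]

/-- **DT-EGC (weak form) ⟹ Kahn's Conjecture 5 / Sahi's `C_3` for every product measure on every finite cube.** [this work] -/
theorem masterFamilyNonneg_three_of_DTEGCWeak (h : DTEGCWeak) : MasterFamilyNonneg 3 := by
  intro ι _ p U hU
  exact sahiE_three_nonneg_of_sahiPositive p (sahiPositive_three_of_DTEGCWeak h _ ι rfl p) U hU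

/-- **DT-EGC ⟹ Kahn's Conjecture 5 / Sahi's `C_3` for every product measure on every finite cube.** [this work] -/
theorem masterFamilyNonneg_three_of_DTEGC' (h : DTEGC') : MasterFamilyNonneg 3 :=
  masterFamilyNonneg_three_of_DTEGCWeak (dtegcWeak_of_dtegc' h)

end SahiCoordinateInduction

end Summit.CriticalPhenomena.PercolationContinuityZ3.Theorems
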